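import Summits.AtomisticToContinuum.Crystallization.Theorems.FrustratedLawDichotomyTwoShellRigidityOctaCellAt
import Summits.AtomisticToContinuum.Crystallization.Theorems.FrustratedLawDichotomyHalfCap

/-!
# FrustratedLawDichotomy · crux `AperiodicFrustratedLawGap` (stmt-AtomisticToContinuum-27623) — the CAP A-PRIORI of the M column
# (decomp-a2c, prover hand 1, gen 11; lens-5 g31 ASK / critic row 452 (b): `CapAprioriAt (3c + 2K) K θ Pat` from `OctaCellAt c`)

lens-5's certified contraction ladder beneath `M = CappedRigidity θ η` (g31 node `TwoShellRigidityLadder`, critic row 452: the L-format of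
record for the M column) enters from the hand lane through TWO a-priori bounds for ONE isometry `A`: the bonded dozen within `K·θ·nn_i`
(`R = CoarseCappedRigidityAt K θ Pat`, landed with `K = 4796` in p822606) and every CAP `m` of a link square (diagonal `u, v`) within
`Kq·θ·nn_i` of the ideal cap `nn_i·A(u+v)` — lens-5's `CapAprioriAt Kq K θ Pat`, the hypothesis `hQf / hQh` of its literal theorem
`cappedRigidity_of_coarse_c18` with `Kq = 54 + 2K`.

This def-free file PROVES the cap a-priori in the tree's vocabulary (the statement of `cap_apriori_fcc` / `cap_apriori_hcp` below is the BODY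
of `CapAprioriAt (54 + 2K) K θ Pat`, so the latter follows by `fun N y i τ hy hsep hL hC A hA u v m huv hmi hb => cap_apriori_fcc hθ0 hθ1 …`
once the ladder file is a tree module):

* `cap_apriori_of_octaCellAt` — for EVERY pattern with the octahedral cell lemma `OctaCellAt c Pat`, the extraction `ExtractionAt θ Pat`
  and the square fact «a `√2`-pair has two common contacts at distance `√2`»: for every `K`, every isometry `A` fitting the dozen within
  `K·θ·nn_i`, every `√2`-pair `u, v` and every `m ≠ i` bonded to `τ` of the four vertices of the square,
  `‖(y m − y i) − nn_i·A(u+v)‖ ≤ (3c + 2K)·θ·nn_i` (`0 < θ ≤ 1/100`).  PROOF: the octahedral cell (centre, square, cap `m`) has its own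
  isometry `B` with all five deviations `≤ c·θ·nn_i` (the cap windows of THIS `m` are two lines of bond-graph arithmetic, `cap_bond_window`);
  `A` and `B` differ by `≤ (c + K)·θ·nn_i` on `u` and on `v`, hence by `≤ 2(c+K)·θ·nn_i` on `u + v` (linearity); triangle inequality.
* `cap_apriori_fcc`, `cap_apriori_hcp` — the two kissing patterns with the landed `c = 18` (`octaCellAt_fcc / _hcp`, p822087):
  `Kq = 54 + 2K`, exactly lens-5's `c = 18` route (`fccEntryC18 = (K, 54+2K, 2K, 54+3K)/100` at `K = 10`).
* pattern facts by `decide` on the integer models, transported through p820589's `dist_eq_sqrt_two_iff_sqNormInt`: the two common contacts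
  of a diagonal pair are themselves a diagonal pair (`fcc_common_contacts_diag`, `hcp_common_contacts_diag`), whence
  `fcc_exists_square_of_diagonal` / `hcp_exists_square_of_diagonal` (the other two vertices `w, w'` of the square, `dist w w' = √2`).

`[folklore]` (elementary); def-free; no `sorry`; `decide` only on the two 12-point integer models.
-/

noncomputable section

namespace Summit.AtomisticToContinuum.Crystallization.Theorems.FrustratedLawDichotomyTwoShellRigidityCapApriori

open Literature.Geometry.DiscreteGeometry
open Summit.AtomisticToContinuum.Crystallization.Theorems.FrustratedLawDichotomyTwoShellRigidityCut (E3 LinkIso Capped)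
open Summit.AtomisticToContinuum.Crystallization.Theorems.FrustratedLawDichotomyTwoShellRigidityCells
  (OctaCellAt ExtractionAt ne_and_dist_ne_one_of_dist_eq_sqrt_two)
open Summit.AtomisticToContinuum.Crystallization.Theorems.FrustratedLawDichotomyTwoShellRigidityExtraction
  (extractionAt_of_contactSeparating)
open Summit.AtomisticToContinuum.Crystallization.Theorems.FrustratedLawDichotomyTwoShellRigidityOctaCellAt (octaCellAt_fcc octaCellAt_hcp)
open Summit.AtomisticToContinuum.Crystallization.Theorems.FrustratedLawDichotomyBondGraphWindows
  (dist_le_sq_mul_nearestDist_of_adj_adj)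
open Summit.AtomisticToContinuum.Crystallization.Theorems.FrustratedLawDichotomyCappedRigidityCertPatterns
  (dist_eq_one_iff_sqNormInt dist_eq_sqrt_two_iff_sqNormInt fcc_contactSeparating hcp_contactSeparating)
open Summit.AtomisticToContinuum.Crystallization.Theorems.FrustratedLawDichotomyCornerPairing (exists_int_of_mem_scaledPattern)
open Summit.AtomisticToContinuum.Crystallization.Theorems.FrustratedLawDichotomyHalfCap (fcc_ncard_common_contacts_of_diagonal)
open Summit.AtomisticToContinuum.Crystallization.Theorems.FrustratedLawDichotomyCornerPairingHalfCap
  (hcp_ncard_common_contacts_of_diagonal)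

/-! ### Pattern facts: the two common contacts of a diagonal pair form the other diagonal of the square -/

set_option maxRecDepth 8000 in
/-- fcc (integer model, cast form): two common contacts of a diagonal pair coincide or are at squared integer distance `4` (`= √2` in
contact units; stated as a disjunction, which `decide` handles within the default instance budget). [folklore] -/
theorem fccInt_common_contacts_diag : ∀ v ∈ fccInt, ∀ w ∈ fccInt, sqNormInt (v - w) = 2 * ((2 : ℕ) : ℤ) →
    ∀ z ∈ fccInt, ∀ z' ∈ fccInt, sqNormInt (v - z) = ((2 : ℕ) : ℤ) → sqNormInt (w - z) = ((2 : ℕ) : ℤ) →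
      sqNormInt (v - z') = ((2 : ℕ) : ℤ) → sqNormInt (w - z') = ((2 : ℕ) : ℤ) → z = z' ∨ sqNormInt (z - z') = 2 * ((2 : ℕ) : ℤ) := by
  decide

set_option maxRecDepth 8000 in
/-- hcp (integer model, cast form): two common contacts of a diagonal pair coincide or are at squared integer distance `36`. [folklore] -/
theorem hcpInt_common_contacts_diag : ∀ v ∈ hcpInt, ∀ w ∈ hcpInt, sqNormInt (v - w) = 2 * ((18 : ℕ) : ℤ) →
    ∀ z ∈ hcpInt, ∀ z' ∈ hcpInt, sqNormInt (v - z) = ((18 : ℕ) : ℤ) → sqNormInt (w - z) = ((18 : ℕ) : ℤ) →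
      sqNormInt (v - z') = ((18 : ℕ) : ℤ) → sqNormInt (w - z') = ((18 : ℕ) : ℤ) → z = z' ∨ sqNormInt (z - z') = 2 * ((18 : ℕ) : ℤ) := by
  decide

/-- Transport of «distinct common contacts of a diagonal pair are a diagonal pair» to a scaled integer pattern. [folklore] -/
theorem common_contacts_diag_scaledPattern {S : Finset (Fin 3 → ℤ)} {N₀ : ℕ} (hN : N₀ ≠ 0)
    (hS : ∀ v ∈ S, ∀ w ∈ S, sqNormInt (v - w) = 2 * (N₀ : ℤ) → ∀ z ∈ S, ∀ z' ∈ S, sqNormInt (v - z) = (N₀ : ℤ) →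
      sqNormInt (w - z) = (N₀ : ℤ) → sqNormInt (v - z') = (N₀ : ℤ) → sqNormInt (w - z') = (N₀ : ℤ) →
      z = z' ∨ sqNormInt (z - z') = 2 * (N₀ : ℤ))
    (u a c c' : ↥(scaledPattern S N₀)) (h : dist (u : E3) (a : E3) = Real.sqrt 2)
    (h1 : dist (u : E3) (c : E3) = 1) (h2 : dist (a : E3) (c : E3) = 1) (h3 : dist (u : E3) (c' : E3) = 1)
    (h4 : dist (a : E3) (c' : E3) = 1) (hne : c ≠ c') : dist (c : E3) (c' : E3) = Real.sqrt 2 := by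
  obtain ⟨v₀, hv₀, hv⟩ := exists_int_of_mem_scaledPattern u
  obtain ⟨w₀, hw₀, hw⟩ := exists_int_of_mem_scaledPattern a
  obtain ⟨z₀, hz₀, hz⟩ := exists_int_of_mem_scaledPattern c
  obtain ⟨z₁, hz₁, hz'⟩ := exists_int_of_mem_scaledPattern c'
  rw [← hv, ← hw] at h
  have hd := (dist_eq_sqrt_two_iff_sqNormInt hN v₀ w₀).1 h
  rw [← hv, ← hz] at h1; rw [← hw, ← hz] at h2; rw [← hv, ← hz'] at h3; rw [← hw, ← hz'] at h4
  have hzz : z₀ ≠ z₁ := by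
    intro hzz; apply hne; apply Subtype.ext; rw [← hz, ← hz', hzz]
  have key := (hS v₀ hv₀ w₀ hw₀ hd z₀ hz₀ z₁ hz₁ ((dist_eq_one_iff_sqNormInt hN v₀ z₀).1 h1)
    ((dist_eq_one_iff_sqNormInt hN w₀ z₀).1 h2) ((dist_eq_one_iff_sqNormInt hN v₀ z₁).1 h3)
    ((dist_eq_one_iff_sqNormInt hN w₀ z₁).1 h4)).resolve_left hzz
  rw [← hz, ← hz']
  exact (dist_eq_sqrt_two_iff_sqNormInt hN z₀ z₁).2 key

/-- fcc: two distinct common contacts of a diagonal pair are at distance `√2`. [folklore] -/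
theorem fcc_common_contacts_diag (u a c c' : ↥fccKissingPattern) (h : dist (u : E3) (a : E3) = Real.sqrt 2)
    (h1 : dist (u : E3) (c : E3) = 1) (h2 : dist (a : E3) (c : E3) = 1) (h3 : dist (u : E3) (c' : E3) = 1)
    (h4 : dist (a : E3) (c' : E3) = 1) (hne : c ≠ c') : dist (c : E3) (c' : E3) = Real.sqrt 2 :=
  common_contacts_diag_scaledPattern two_ne_zero fccInt_common_contacts_diag u a c c' h h1 h2 h3 h4 hne

/-- hcp: two distinct common contacts of a diagonal pair are at distance `√2`. [folklore] -/
theorem hcp_common_contacts_diag (u a c c' : ↥hcpKissingPattern) (h : dist (u : E3) (a : E3) = Real.sqrt 2)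
    (h1 : dist (u : E3) (c : E3) = 1) (h2 : dist (a : E3) (c : E3) = 1) (h3 : dist (u : E3) (c' : E3) = 1)
    (h4 : dist (a : E3) (c' : E3) = 1) (hne : c ≠ c') : dist (c : E3) (c' : E3) = Real.sqrt 2 :=
  common_contacts_diag_scaledPattern (by norm_num) hcpInt_common_contacts_diag u a c c' h h1 h2 h3 h4 hne

/-- **The square of a diagonal pair** (abstract pattern): if every diagonal pair has exactly two common contacts and those are at distance
`√2`, then every diagonal pair `u, v` has the two other vertices `w, w'` of its square, `dist w w' = √2`. [folklore] -/
theorem exists_square_of_diagonal {Pat : Finset E3}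
    (h2 : ∀ a b : ↥Pat, dist (a : E3) (b : E3) = Real.sqrt 2 →
      ({c : ↥Pat | dist (a : E3) (c : E3) = 1} ∩ {c : ↥Pat | dist (b : E3) (c : E3) = 1}).ncard = 2)
    (hdg : ∀ a b c c' : ↥Pat, dist (a : E3) (b : E3) = Real.sqrt 2 → dist (a : E3) (c : E3) = 1 → dist (b : E3) (c : E3) = 1 →
      dist (a : E3) (c' : E3) = 1 → dist (b : E3) (c' : E3) = 1 → c ≠ c' → dist (c : E3) (c' : E3) = Real.sqrt 2)
    (u v : ↥Pat) (huv : dist (u : E3) (v : E3) = Real.sqrt 2) :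
    ∃ w w' : ↥Pat, dist (w : E3) (u : E3) = 1 ∧ dist (w : E3) (v : E3) = 1 ∧ dist (w' : E3) (u : E3) = 1 ∧
      dist (w' : E3) (v : E3) = 1 ∧ dist (w : E3) (w' : E3) = Real.sqrt 2 := by
  obtain ⟨x₁, x₂, hne, hS⟩ := Set.ncard_eq_two.1 (h2 u v huv)
  have hx₁ : x₁ ∈ ({c : ↥Pat | dist (u : E3) (c : E3) = 1} ∩ {c : ↥Pat | dist (v : E3) (c : E3) = 1}) := by
    rw [hS]; simp
  have hx₂ : x₂ ∈ ({c : ↥Pat | dist (u : E3) (c : E3) = 1} ∩ {c : ↥Pat | dist (v : E3) (c : E3) = 1}) := by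
    rw [hS]; simp
  obtain ⟨h1u, h1v⟩ := hx₁
  obtain ⟨h2u, h2v⟩ := hx₂
  have h1u' : dist (u : E3) (x₁ : E3) = 1 := h1u
  have h1v' : dist (v : E3) (x₁ : E3) = 1 := h1v
  have h2u' : dist (u : E3) (x₂ : E3) = 1 := h2u
  have h2v' : dist (v : E3) (x₂ : E3) = 1 := h2v
  refine ⟨x₁, x₂, ?_, ?_, ?_, ?_, hdg u v x₁ x₂ huv h1u' h1v' h2u' h2v' hne⟩
  · rw [dist_comm]; exact h1u'
  · rw [dist_comm]; exact h1v'
  · rw [dist_comm]; exact h2u'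
  · rw [dist_comm]; exact h2v'

/-- **fcc: the square of a diagonal pair.** [folklore] -/
theorem fcc_exists_square_of_diagonal (u v : ↥fccKissingPattern) (huv : dist (u : E3) (v : E3) = Real.sqrt 2) :
    ∃ w w' : ↥fccKissingPattern, dist (w : E3) (u : E3) = 1 ∧ dist (w : E3) (v : E3) = 1 ∧ dist (w' : E3) (u : E3) = 1 ∧
      dist (w' : E3) (v : E3) = 1 ∧ dist (w : E3) (w' : E3) = Real.sqrt 2 :=
  exists_square_of_diagonal fcc_ncard_common_contacts_of_diagonal fcc_common_contacts_diag u v huv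

/-- **hcp: the square of a diagonal pair.** [folklore] -/
theorem hcp_exists_square_of_diagonal (u v : ↥hcpKissingPattern) (huv : dist (u : E3) (v : E3) = Real.sqrt 2) :
    ∃ w w' : ↥hcpKissingPattern, dist (w : E3) (u : E3) = 1 ∧ dist (w : E3) (v : E3) = 1 ∧ dist (w' : E3) (u : E3) = 1 ∧
      dist (w' : E3) (v : E3) = 1 ∧ dist (w : E3) (w' : E3) = Real.sqrt 2 :=
  exists_square_of_diagonal hcp_ncard_common_contacts_of_diagonal hcp_common_contacts_diag u v huv

/-! ### The cap windows of a GIVEN cap site `m` (bond-graph arithmetic at the centre's scale `nn_i`) -/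

/-- **Cap-bond window**: if `i ∼ j` and `m ∼ j` (`θ ≥ 0`) then the relative positions `y m − y i`, `y j − y i` are at distance in
`[nn_i/(1+θ), (1+θ)²·nn_i]`. [folklore] -/
theorem cap_bond_window {θ : ℝ} (hθ : 0 ≤ θ) {N : ℕ} {y : Fin N → E3} {i j m : Fin N}
    (hij : (bondGraph θ y).Adj i j) (hmj : (bondGraph θ y).Adj m j) :
    nearestDist y i / (1 + θ) ≤ dist (y m - y i) (y j - y i) ∧ dist (y m - y i) (y j - y i) ≤ (1 + θ) ^ 2 * nearestDist y i := by
  have hθ' : 0 ≤ 1 + θ := by linarith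
  have hpos : 0 < 1 + θ := by linarith
  rw [dist_sub_right, dist_comm]
  refine ⟨?_, dist_le_sq_mul_nearestDist_of_adj_adj hθ' hij hmj.symm⟩
  rw [div_le_iff₀ hpos]
  have h1 : nearestDist y i ≤ (1 + θ) * nearestDist y j := nearestDist_le_mul_of_adj hθ' hij
  have h2 : nearestDist y j ≤ dist (y j) (y m) := nearestDist_le_dist y hmj.ne
  nlinarith

/-- **Centre–cap window**: a site `m ≠ i` is at distance `≥ nn_i ≥ nn_i/(1+θ)` from `i` (`θ ≥ 0`). [folklore] -/
theorem norm_cap_ge {θ : ℝ} (hθ : 0 ≤ θ) {N : ℕ} {y : Fin N → E3} {i m : Fin N} (hmi : m ≠ i) :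
    nearestDist y i / (1 + θ) ≤ ‖y m - y i‖ := by
  have h1 : nearestDist y i ≤ ‖y m - y i‖ := by
    rw [← dist_eq_norm, dist_comm]
    exact nearestDist_le_dist y hmi
  exact (div_le_self (nearestDist_nonneg y i) (by linarith)).trans h1

/-! ### The cap a-priori -/

/-- **THE CAP A-PRIORI from the octahedral cell lemma** (abstract pattern): `OctaCellAt c Pat`, `ExtractionAt θ Pat` and the square fact give,
for every `K`, every isometry `A` fitting the bonded dozen within `K·θ·nn_i`, every diagonal pair `u, v` and every `m ≠ i` bonded to `τ` of the
four vertices of the square: `‖(y m − y i) − nn_i·A(u+v)‖ ≤ (3c + 2K)·θ·nn_i` (`0 < θ ≤ 1/100`).  This is the BODY of lens-5's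
`CapAprioriAt (3c + 2K) K θ Pat`. [folklore] -/
theorem cap_apriori_of_octaCellAt {c K θ : ℝ} {Pat : Finset E3} (hθ0 : 0 < θ) (hθ1 : θ ≤ 1 / 100) (hO : OctaCellAt c Pat)
    (hE : ExtractionAt θ Pat)
    (hsq : ∀ u v : ↥Pat, dist (u : E3) (v : E3) = Real.sqrt 2 → ∃ w w' : ↥Pat,
      dist (w : E3) (u : E3) = 1 ∧ dist (w : E3) (v : E3) = 1 ∧ dist (w' : E3) (u : E3) = 1 ∧ dist (w' : E3) (v : E3) = 1 ∧
        dist (w : E3) (w' : E3) = Real.sqrt 2) :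
    ∀ (N : ℕ) (y : Fin N → E3) (i : Fin N) (τ : ↥Pat → Fin N), Function.Injective y →
      (∀ a b : Fin N, a ≠ b → (7 : ℝ) / 10 ≤ dist (y a) (y b)) → LinkIso θ Pat y i τ → Capped θ Pat y i τ →
        ∀ A : E3 →ₗᵢ[ℝ] E3, (∀ u : ↥Pat, ‖(y (τ u) - y i) - nearestDist y i • A (u : E3)‖ ≤ K * θ * nearestDist y i) →
          ∀ (u v : ↥Pat) (m : Fin N), dist (u : E3) (v : E3) = Real.sqrt 2 → m ≠ i →
            (∀ w : ↥Pat, (w = u ∨ w = v ∨ (dist (w : E3) (u : E3) = 1 ∧ dist (w : E3) (v : E3) = 1)) →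
              (bondGraph θ y).Adj m (τ w)) →
              ‖(y m - y i) - nearestDist y i • A ((u : E3) + (v : E3))‖ ≤ (3 * c + 2 * K) * θ * nearestDist y i := by
  intro N y i τ hy hsep hL hC A hA u v m huv hmi hb
  obtain ⟨hd, hrad, hbond, hdiag, -⟩ := hE N y i τ hy hsep hL hC
  obtain ⟨w, w', hwu, hwv, hw'u, hw'v, hww'⟩ := hsq u v huv
  -- the windows of the octahedral cell (centre, square `u w v w'`, cap `m`)
  have key : ∀ z z' : ↥Pat, (z = u ∨ z = v) → (z' = w ∨ z' = w') → dist (z : E3) (z' : E3) = 1 := by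
    rintro z z' (rfl | rfl) (rfl | rfl) <;> rw [dist_comm] <;> assumption
  have key' : ∀ z : ↥Pat, (z = u ∨ z = v ∨ z = w ∨ z = w') →
      (z = u ∨ z = v ∨ (dist (z : E3) (u : E3) = 1 ∧ dist (z : E3) (v : E3) = 1)) := by
    rintro z (rfl | rfl | rfl | rfl)
    · exact Or.inl rfl
    · exact Or.inr (Or.inl rfl)
    · exact Or.inr (Or.inr ⟨hwu, hwv⟩)
    · exact Or.inr (Or.inr ⟨hw'u, hw'v⟩)
  have hcap : ∀ z : ↥Pat, (z = u ∨ z = v ∨ z = w ∨ z = w') →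
      nearestDist y i / (1 + θ) ≤ dist (y m - y i) (y (τ z) - y i) ∧
        dist (y m - y i) (y (τ z) - y i) ≤ (1 + θ) ^ 2 * nearestDist y i :=
    fun z hz => cap_bond_window hθ0.le (hL.1 z) (hb z (key' z hz))
  obtain ⟨B, hB, hBq⟩ := hO θ (nearestDist y i) hθ0 hθ1 hd u v w w' huv hwu hwv hw'u hw'v hww' (fun z => y (τ z) - y i)
    (y m - y i) (fun z _ => hrad z) (fun z z' hz hz' => hbond z z' (key z z' hz hz')) hcap
    (hdiag u v (ne_and_dist_ne_one_of_dist_eq_sqrt_two huv).1 (ne_and_dist_ne_one_of_dist_eq_sqrt_two huv).2)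
    (hdiag w w' (ne_and_dist_ne_one_of_dist_eq_sqrt_two hww').1 (ne_and_dist_ne_one_of_dist_eq_sqrt_two hww').2)
    (norm_cap_ge hθ0.le hmi)
  -- comparison of the two isometries on `u` and `v`
  have hBu : ‖(y (τ u) - y i) - nearestDist y i • B (u : E3)‖ ≤ c * θ * nearestDist y i := hB u (Or.inl rfl)
  have hBv : ‖(y (τ v) - y i) - nearestDist y i • B (v : E3)‖ ≤ c * θ * nearestDist y i := hB v (Or.inr (Or.inl rfl))
  have hAu := hA u
  have hAv := hA v
  have hsplit : (y m - y i) - nearestDist y i • A ((u : E3) + (v : E3)) =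
      ((y m - y i) - nearestDist y i • B ((u : E3) + (v : E3))) +
        ((nearestDist y i • B (u : E3) - (y (τ u) - y i)) + ((y (τ u) - y i) - nearestDist y i • A (u : E3))) +
        ((nearestDist y i • B (v : E3) - (y (τ v) - y i)) + ((y (τ v) - y i) - nearestDist y i • A (v : E3))) := by
    rw [map_add, map_add, smul_add, smul_add]; abel
  have hBu' : ‖nearestDist y i • B (u : E3) - (y (τ u) - y i)‖ ≤ c * θ * nearestDist y i := by rw [norm_sub_rev]; exact hBu
  have hBv' : ‖nearestDist y i • B (v : E3) - (y (τ v) - y i)‖ ≤ c * θ * nearestDist y i := by rw [norm_sub_rev]; exact hBv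
  calc ‖(y m - y i) - nearestDist y i • A ((u : E3) + (v : E3))‖
      = ‖((y m - y i) - nearestDist y i • B ((u : E3) + (v : E3))) +
          ((nearestDist y i • B (u : E3) - (y (τ u) - y i)) + ((y (τ u) - y i) - nearestDist y i • A (u : E3))) +
          ((nearestDist y i • B (v : E3) - (y (τ v) - y i)) + ((y (τ v) - y i) - nearestDist y i • A (v : E3)))‖ := by
        rw [← hsplit]
    _ ≤ ‖(y m - y i) - nearestDist y i • B ((u : E3) + (v : E3))‖ +
          ‖(nearestDist y i • B (u : E3) - (y (τ u) - y i)) + ((y (τ u) - y i) - nearestDist y i • A (u : E3))‖ +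
          ‖(nearestDist y i • B (v : E3) - (y (τ v) - y i)) + ((y (τ v) - y i) - nearestDist y i • A (v : E3))‖ :=
        norm_add₃_le
    _ ≤ c * θ * nearestDist y i + (c * θ * nearestDist y i + K * θ * nearestDist y i) +
          (c * θ * nearestDist y i + K * θ * nearestDist y i) := by
        gcongr
        · exact (norm_add_le _ _).trans (add_le_add hBu' hAu)
        · exact (norm_add_le _ _).trans (add_le_add hBv' hAv)
    _ = (3 * c + 2 * K) * θ * nearestDist y i := by ring

/-- **THE CAP A-PRIORI, fcc, `Kq = 54 + 2K`** (from `OctaCellAt 18 fccKissingPattern`, p822087): for `0 < θ ≤ 1/100`, every `K`, every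
isometry `A` fitting the bonded dozen within `K·θ·nn_i`, every cap `m` of a link square (diagonal `u, v`) is within `(54 + 2K)·θ·nn_i` of
`nn_i·A(u+v)` — the body of lens-5's `CapAprioriAt (54 + 2 * K) K θ fccKissingPattern` (hypothesis `hQf` of `cappedRigidity_of_coarse_c18`).
[folklore] -/
theorem cap_apriori_fcc {K θ : ℝ} (hθ0 : 0 < θ) (hθ1 : θ ≤ 1 / 100) :
    ∀ (N : ℕ) (y : Fin N → E3) (i : Fin N) (τ : ↥fccKissingPattern → Fin N), Function.Injective y →
      (∀ a b : Fin N, a ≠ b → (7 : ℝ) / 10 ≤ dist (y a) (y b)) → LinkIso θ fccKissingPattern y i τ →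
        Capped θ fccKissingPattern y i τ →
        ∀ A : E3 →ₗᵢ[ℝ] E3,
          (∀ u : ↥fccKissingPattern, ‖(y (τ u) - y i) - nearestDist y i • A (u : E3)‖ ≤ K * θ * nearestDist y i) →
          ∀ (u v : ↥fccKissingPattern) (m : Fin N), dist (u : E3) (v : E3) = Real.sqrt 2 → m ≠ i →
            (∀ w : ↥fccKissingPattern, (w = u ∨ w = v ∨ (dist (w : E3) (u : E3) = 1 ∧ dist (w : E3) (v : E3) = 1)) →
              (bondGraph θ y).Adj m (τ w)) →
              ‖(y m - y i) - nearestDist y i • A ((u : E3) + (v : E3))‖ ≤ (54 + 2 * K) * θ * nearestDist y i := by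
  have hf : fccKissingPattern.Nonempty := Finset.card_pos.1 (by rw [card_fccKissingPattern]; norm_num)
  have h := cap_apriori_of_octaCellAt (K := K) hθ0 hθ1 octaCellAt_fcc (extractionAt_of_contactSeparating hθ0.le hf fcc_contactSeparating)
    fcc_exists_square_of_diagonal
  have e : (3 * (18 : ℝ) + 2 * K) = 54 + 2 * K := by norm_num
  rw [e] at h
  exact h

/-- **THE CAP A-PRIORI, hcp, `Kq = 54 + 2K`** (from `OctaCellAt 18 hcpKissingPattern`): the body of lens-5's
`CapAprioriAt (54 + 2 * K) K θ hcpKissingPattern` (hypothesis `hQh` of `cappedRigidity_of_coarse_c18`). [folklore] -/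
theorem cap_apriori_hcp {K θ : ℝ} (hθ0 : 0 < θ) (hθ1 : θ ≤ 1 / 100) :
    ∀ (N : ℕ) (y : Fin N → E3) (i : Fin N) (τ : ↥hcpKissingPattern → Fin N), Function.Injective y →
      (∀ a b : Fin N, a ≠ b → (7 : ℝ) / 10 ≤ dist (y a) (y b)) → LinkIso θ hcpKissingPattern y i τ →
        Capped θ hcpKissingPattern y i τ →
        ∀ A : E3 →ₗᵢ[ℝ] E3,
          (∀ u : ↥hcpKissingPattern, ‖(y (τ u) - y i) - nearestDist y i • A (u : E3)‖ ≤ K * θ * nearestDist y i) →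
          ∀ (u v : ↥hcpKissingPattern) (m : Fin N), dist (u : E3) (v : E3) = Real.sqrt 2 → m ≠ i →
            (∀ w : ↥hcpKissingPattern, (w = u ∨ w = v ∨ (dist (w : E3) (u : E3) = 1 ∧ dist (w : E3) (v : E3) = 1)) →
              (bondGraph θ y).Adj m (τ w)) →
              ‖(y m - y i) - nearestDist y i • A ((u : E3) + (v : E3))‖ ≤ (54 + 2 * K) * θ * nearestDist y i := by
  have hh : hcpKissingPattern.Nonempty := Finset.card_pos.1 (by rw [card_hcpKissingPattern]; norm_num)
  have h := cap_apriori_of_octaCellAt (K := K) hθ0 hθ1 octaCellAt_hcp (extractionAt_of_contactSeparating hθ0.le hh hcp_contactSeparating)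
    hcp_exists_square_of_diagonal
  have e : (3 * (18 : ℝ) + 2 * K) = 54 + 2 * K := by norm_num
  rw [e] at h
  exact h

end Summit.AtomisticToContinuum.Crystallization.Theorems.FrustratedLawDichotomyTwoShellRigidityCapApriori

end
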